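import Literature.MathematicalPhysics.PowerSystems.LuriePostnikovSlabPositivityDualCompleteness
import HarnessLib

/-!
# The tree's dual-witness receptacles are EXACT: for slopes `a₀ < b₀`, the certificate class with
# sectors at least `[a₀, b₀]` is empty IFF a `SlabDualWitness` (resp. `LPSlabDualWitness`) at
# `(a₀, b₀)` exists — and emptiness AT the slopes already decides emptiness for all wider sectors

Topic `Literature/MathematicalPhysics/PowerSystems`, namespace
`Literature.MathematicalPhysics.PowerSystems.LyapunovFunctionFamily`.  This short module closes the
circle between the receptacles the cell's «EMPTY from γ₀» rows actually instantiate —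
`SlabDualWitness S a₀ b₀` (`LuriePostnikovSlabDualWitness.lean`: (D1)–(D3), `a₀ < b₀`, `tr Z₁₁ > 0`;
refutes every certificate with WIDER sectors `a ≤ a₀`, `b₀ ≤ b`) and its positivity analogue
`LPSlabDualWitness` (`LuriePostnikovSlabPositivityDual.lean`) — and the theorems of strong
alternatives of `LuriePostnikovSlabDualCompleteness.lean` / `LuriePostnikovSlabPositivityDualCompleteness.lean`
(stated with the relaxed `SlabFarkasWitness` / `LPSlabFarkasWitness` and with slopes EQUAL to
`(a₀, b₀)`).  Everything is PROVED; no definition, no named fact.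

Two observations, both elementary once the strong alternative is in the tree:

* §1 `SlabFarkasWitness.trace_pos` / `LPSlabFarkasWitness.trace_pos` — under `Z ⪰ 0` the
  nondegeneracy disjunction `0 < tr Z₁₁ ∨ W + Wᵀ ≠ 0` already forces `0 < tr Z₁₁` (`tr Z₁₁ = 0 ⇒
  Z₁₁ = 0 ⇒ Z₂₁ = 0` by the zero-pivot rule, whence `W = Z₁₁Aᵀ + AZ₁₁ − 2BZ₂₁ = 0`).  So a Farkas
  witness at slopes `a₀ < b₀` IS a dual witness of the tree's receptacle:
  `SlabFarkasWitness.toDualWitness`, `LPSlabFarkasWitness.toLPDualWitness` (observation first made by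
  referee ref-2 g18 on ★ #243's bytes, 2026-08-28).
* §2 the exactness theorems in the receptacles' OWN semantics, for every Lur'e system and all slopes
  with `a₀ < b₀` componentwise:
  `isEmpty_iff_nonempty_slabDualWitness` — «no `SlabCertificate` with slopes `(a₀, b₀)`» ⟺
  «a `SlabDualWitness S a₀ b₀` exists»; `isEmpty_wider_iff_isEmpty` — emptiness of the class with
  sectors AT LEAST `[a₀, b₀]` ⟺ emptiness AT `[a₀, b₀]` (so bisection at the window's own slopes
  loses nothing — the «sector monotonicity of the class», obtained here by DUALITY rather than by the
  S-lemma rescaling of the multipliers); `slabCertificate_wider_xor_slabDualWitness` — EXACTLY ONE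
  of: a certificate with sectors at least `[a₀, b₀]` exists; a `SlabDualWitness S a₀ b₀` exists;
  `exists_at_slopes_of_exists_wider` — a certificate on a wider sector yields (non-constructively)
  one AT the slopes.  The same four statements for the positivity class (`lp_…`).

Source: as the two completeness files — S. Boyd, L. Vandenberghe, *Convex Optimization*, CUP 2004
[BoydVandenberghe2004], §5.9.4 «Strong alternatives» (5.99)–(5.100) and Example 5.14 (held
`book:boydnd-convex-optimization`, chunks p0238–p0239, printed pp. 269–270): «strong alternatives
… exactly one of the two alternatives holds» (§5.8.2 p. 260 for the term); R. A. Horn,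
C. R. Johnson, *Matrix Analysis*, 2nd ed. [HornJohnson2013], §7.1 Observation 7.1.10 (zero diagonal
entry ⇒ zero row/column; tree `PsdZeroPivotRule`).

THREE COLUMNS.  CERTIFIED: statements about the certificate CLASSES `SlabCertificate` /
`LPSlabCertificate` and the receptacles `SlabDualWitness` / `LPSlabDualWitness` — the objects of the
cell's G2.c bracket rows — for every Lur'e system; nothing numerical, nothing about trajectories
beyond what the classes certify.  VALIDATED: which alternative holds for an instance is decided by
the rows' exact data.  MODELLED: as the instance says.  Nothing here says a grid is stable.
-/

noncomputable section

open Matrix Finset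

namespace Literature.MathematicalPhysics.PowerSystems.LyapunovFunctionFamily

variable {ι κ : Type*} [Fintype ι] [Fintype κ] [DecidableEq ι] [DecidableEq κ]

/-! ## §1 Under `Z ⪰ 0` the nondegeneracy disjunction is `tr Z₁₁ > 0` -/

section TracePos

variable {S : System ι κ} {a₀ b₀ : κ → ℝ}

/-- The mechanism: for `Z = [[Z₁₁, Z₂₁ᵀ], [Z₂₁, Z₂₂]] ⪰ 0`, if `W + Wᵀ ≠ 0` then `tr Z₁₁ > 0`
(`tr Z₁₁ = 0 ⇒ Z₁₁ = 0 ⇒ Z₂₁ = 0 ⇒ W = 0`). [cite: HornJohnson2013, §7.1 Observation 7.1.10 (zero diagonal entry ⇒ zero row and column)] -/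
theorem trace_pos_of_psd_of_adjP_ne_zero {Z₁₁ : Matrix ι ι ℝ} {Z₂₁ : Matrix κ ι ℝ}
    {Z₂₂ : Matrix κ κ ℝ} (hpsd : (fromBlocks Z₁₁ Z₂₁ᵀ Z₂₁ Z₂₂).PosSemidef)
    (hW : dualAdjP S Z₁₁ Z₂₁ + (dualAdjP S Z₁₁ Z₂₁)ᵀ ≠ 0) : 0 < trace Z₁₁ := by
  have h11 : Z₁₁.PosSemidef := hpsd.submatrix Sum.inl
  by_contra hle
  have htr0 : trace Z₁₁ = 0 := le_antisymm (not_lt.mp hle) h11.trace_nonneg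
  have hZ11 : Z₁₁ = 0 := eq_zero_of_posSemidef_of_trace_eq_zero h11 htr0
  have hZ21 : Z₂₁ = 0 := by
    have hpsd' : (fromBlocks (0 : Matrix ι ι ℝ) Z₂₁ᵀ Z₂₁ᵀᵀ Z₂₂).PosSemidef := by
      rw [transpose_transpose, ← hZ11]
      exact hpsd
    have h1 := ((Literature.Computation.Certificates.PsdZeroPivotRule.posSemidef_fromBlocks_zero₁₁_iff
      _ _).mp hpsd').1
    have h2 := congrArg Matrix.transpose h1
    rwa [transpose_transpose, transpose_zero] at h2
  apply hW
  simp [dualAdjP, hZ11, hZ21]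

namespace SlabFarkasWitness

variable (D : SlabFarkasWitness S a₀ b₀)

/-- A Farkas witness has `tr Z₁₁ > 0` (its disjunctive nondegeneracy collapses under `Z ⪰ 0`).
[cite: HornJohnson2013, §7.1 Observation 7.1.10; BoydVandenberghe2004, §5.9.4 (5.100) (`λ ≠ 0`)] -/
theorem trace_pos : 0 < trace D.Z₁₁ := by
  rcases D.nondeg with h | hW
  · exact h
  · exact trace_pos_of_psd_of_adjP_ne_zero D.psd hW

/-- **A Farkas witness at slopes `a₀ < b₀` IS a dual witness of the tree's receptacle.**
[cite: BoydVandenberghe2004, §5.9.4 (5.100) and Example 5.14] -/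
def toDualWitness (hlt : ∀ k, a₀ k < b₀ k) : SlabDualWitness S a₀ b₀ where
  Z₁₁ := D.Z₁₁
  Z₂₁ := D.Z₂₁
  Z₂₂ := D.Z₂₂
  psd := D.psd
  adjP_psd := D.adjP_psd
  sectorCoeff_nonneg := D.sectorCoeff_nonneg
  popovCoeff_nonneg := D.popovCoeff_nonneg
  slope_lt := hlt
  trace_pos := D.trace_pos

end SlabFarkasWitness

namespace LPSlabFarkasWitness

variable (D : LPSlabFarkasWitness S a₀ b₀)

/-- An LP Farkas witness has `tr Z₁₁ > 0`. [cite: HornJohnson2013, §7.1 Observation 7.1.10; BoydVandenberghe2004, §5.9.4 (5.100)] -/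
theorem trace_pos : 0 < trace D.Z₁₁ := by
  rcases D.nondeg with h | hW
  · exact h
  · exact trace_pos_of_psd_of_adjP_ne_zero D.psd hW

/-- **An LP Farkas witness at slopes `a₀ < b₀` IS an LP dual witness of the tree's receptacle.**
[cite: BoydVandenberghe2004, §5.9.4 (5.100) and Example 5.14] -/
def toLPDualWitness (hlt : ∀ k, a₀ k < b₀ k) : LPSlabDualWitness S a₀ b₀ where
  Z₁₁ := D.Z₁₁
  Z₂₁ := D.Z₂₁
  Z₂₂ := D.Z₂₂
  psd := D.psd
  adjP_psd := D.adjP_psd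
  sectorCoeff_nonneg := D.sectorCoeff_nonneg
  lowerPopovCoeff_le := D.lowerPopovCoeff_le
  slope_lt := hlt
  trace_pos := D.trace_pos

end LPSlabFarkasWitness

end TracePos

/-! ## §2 Exactness of the receptacles in their own (wider-sector) semantics -/

section Exactness

variable (S : System ι κ) {a₀ b₀ : κ → ℝ}

/-- **The class-of-record receptacle is exact**: for slopes `a₀ < b₀`, NO `SlabCertificate S` has
slopes `(a₀, b₀)` IFF a `SlabDualWitness S a₀ b₀` exists.
[cite: BoydVandenberghe2004, §5.9.4 (5.99)–(5.100) «strong alternatives» and Example 5.14] -/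
theorem isEmpty_iff_nonempty_slabDualWitness (hlt : ∀ k, a₀ k < b₀ k) :
    IsEmpty {Λ : SlabCertificate S // Λ.a = a₀ ∧ Λ.b = b₀} ↔ Nonempty (SlabDualWitness S a₀ b₀) := by
  constructor
  · intro h
    obtain ⟨D⟩ := exists_farkasWitness_of_isEmpty S a₀ b₀ h
    exact ⟨D.toDualWitness hlt⟩
  · rintro ⟨D⟩
    exact SlabCertificate.isEmpty_of_farkasWitness D.toFarkas

/-- **Sector monotonicity of the class, by duality**: for `a₀ < b₀`, the class with sectors AT LEAST
`[a₀, b₀]` (`a ≤ a₀`, `b₀ ≤ b`) is empty IFF the class with sectors EXACTLY `[a₀, b₀]` is empty —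
the wider class is refuted by the dual witness that emptiness at the slopes produces.
[cite: BoydVandenberghe2004, §5.9.4 (5.99)–(5.100) and Example 5.14] -/
theorem isEmpty_wider_iff_isEmpty (hlt : ∀ k, a₀ k < b₀ k) :
    IsEmpty {Λ : SlabCertificate S // (∀ k, Λ.a k ≤ a₀ k) ∧ ∀ k, b₀ k ≤ Λ.b k} ↔
      IsEmpty {Λ : SlabCertificate S // Λ.a = a₀ ∧ Λ.b = b₀} := by
  constructor
  · intro h
    exact ⟨fun ⟨Λ, ha, hb⟩ => h.false ⟨Λ, fun k => (congrFun ha k).le, fun k => (congrFun hb k).ge⟩⟩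
  · intro h
    obtain ⟨D⟩ := (isEmpty_iff_nonempty_slabDualWitness S hlt).mp h
    exact SlabCertificate.isEmpty_of_dualWitness D

/-- **The receptacle in its own semantics is exact**: for `a₀ < b₀`, the class with sectors at least
`[a₀, b₀]` is empty IFF a `SlabDualWitness S a₀ b₀` exists.
[cite: BoydVandenberghe2004, §5.9.4 (5.99)–(5.100) and Example 5.14] -/
theorem isEmpty_wider_iff_nonempty_slabDualWitness (hlt : ∀ k, a₀ k < b₀ k) :
    IsEmpty {Λ : SlabCertificate S // (∀ k, Λ.a k ≤ a₀ k) ∧ ∀ k, b₀ k ≤ Λ.b k} ↔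
      Nonempty (SlabDualWitness S a₀ b₀) :=
  (isEmpty_wider_iff_isEmpty S hlt).trans (isEmpty_iff_nonempty_slabDualWitness S hlt)

/-- **THE THEOREM OF ALTERNATIVES in the tree's receptacle**: for every Lur'e system and all slopes
`a₀ < b₀`, EXACTLY ONE of — (i) a `SlabCertificate S` with sectors at least `[a₀_k, b₀_k]` exists;
(ii) a `SlabDualWitness S a₀ b₀` exists.
[cite: BoydVandenberghe2004, §5.9.4 «strong alternatives … exactly one of the two alternatives holds» (5.99)–(5.100), §5.8.2 p. 260, Example 5.14] -/
theorem slabCertificate_wider_xor_slabDualWitness (hlt : ∀ k, a₀ k < b₀ k) :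
    Xor (Nonempty {Λ : SlabCertificate S // (∀ k, Λ.a k ≤ a₀ k) ∧ ∀ k, b₀ k ≤ Λ.b k})
      (Nonempty (SlabDualWitness S a₀ b₀)) := by
  rcases isEmpty_or_nonempty
      {Λ : SlabCertificate S // (∀ k, Λ.a k ≤ a₀ k) ∧ ∀ k, b₀ k ≤ Λ.b k} with h | h
  · exact Or.inr ⟨(isEmpty_wider_iff_nonempty_slabDualWitness S hlt).mp h, not_nonempty_iff.mpr h⟩
  · exact Or.inl ⟨h, fun ⟨D⟩ => (SlabCertificate.isEmpty_of_dualWitness D).false h.some⟩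

/-- **Restriction to the slopes (existence, by duality)**: a certificate on a wider sector
`a ≤ a₀ < b₀ ≤ b` yields one with slopes EXACTLY `(a₀, b₀)`.
[cite: BoydVandenberghe2004, §5.9.4 (5.99)–(5.100) and Example 5.14] -/
theorem exists_at_slopes_of_exists_wider (hlt : ∀ k, a₀ k < b₀ k) (Λ : SlabCertificate S)
    (ha : ∀ k, Λ.a k ≤ a₀ k) (hb : ∀ k, b₀ k ≤ Λ.b k) :
    ∃ Λ' : SlabCertificate S, Λ'.a = a₀ ∧ Λ'.b = b₀ := by
  by_contra hne
  have hempty : IsEmpty {Λ : SlabCertificate S // Λ.a = a₀ ∧ Λ.b = b₀} :=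
    ⟨fun ⟨Λ', h'⟩ => hne ⟨Λ', h'⟩⟩
  have hw := (isEmpty_wider_iff_isEmpty S hlt).mpr hempty
  exact hw.false ⟨Λ, ha, hb⟩

/-- **The positivity receptacle is exact**: for `a₀ < b₀`, NO `LPSlabCertificate S` has slopes
`(a₀, b₀)` IFF an `LPSlabDualWitness S a₀ b₀` exists.
[cite: BoydVandenberghe2004, §5.9.4 (5.99)–(5.100) and Example 5.14] -/
theorem lp_isEmpty_iff_nonempty_lpDualWitness (hlt : ∀ k, a₀ k < b₀ k) :
    IsEmpty {Λ : LPSlabCertificate S // Λ.a = a₀ ∧ Λ.b = b₀} ↔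
      Nonempty (LPSlabDualWitness S a₀ b₀) := by
  constructor
  · intro h
    obtain ⟨D⟩ := exists_lpFarkasWitness_of_isEmpty S a₀ b₀ h
    exact ⟨D.toLPDualWitness hlt⟩
  · rintro ⟨D⟩
    exact LPSlabCertificate.isEmpty_of_lpFarkasWitness D.toFarkas

/-- Sector monotonicity of the positivity class, by duality. [cite: BoydVandenberghe2004, §5.9.4 (5.99)–(5.100) and Example 5.14] -/
theorem lp_isEmpty_wider_iff_isEmpty (hlt : ∀ k, a₀ k < b₀ k) :
    IsEmpty {Λ : LPSlabCertificate S // (∀ k, Λ.a k ≤ a₀ k) ∧ ∀ k, b₀ k ≤ Λ.b k} ↔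
      IsEmpty {Λ : LPSlabCertificate S // Λ.a = a₀ ∧ Λ.b = b₀} := by
  constructor
  · intro h
    exact ⟨fun ⟨Λ, ha, hb⟩ => h.false ⟨Λ, fun k => (congrFun ha k).le, fun k => (congrFun hb k).ge⟩⟩
  · intro h
    obtain ⟨D⟩ := (lp_isEmpty_iff_nonempty_lpDualWitness S hlt).mp h
    exact LPSlabCertificate.isEmpty_of_lpDualWitness D

/-- The positivity receptacle in its own semantics is exact. [cite: BoydVandenberghe2004, §5.9.4 (5.99)–(5.100) and Example 5.14] -/
theorem lp_isEmpty_wider_iff_nonempty_lpDualWitness (hlt : ∀ k, a₀ k < b₀ k) :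
    IsEmpty {Λ : LPSlabCertificate S // (∀ k, Λ.a k ≤ a₀ k) ∧ ∀ k, b₀ k ≤ Λ.b k} ↔
      Nonempty (LPSlabDualWitness S a₀ b₀) :=
  (lp_isEmpty_wider_iff_isEmpty S hlt).trans (lp_isEmpty_iff_nonempty_lpDualWitness S hlt)

/-- **THE THEOREM OF ALTERNATIVES in the positivity receptacle**: for all slopes `a₀ < b₀`, EXACTLY
ONE of — (i) an `LPSlabCertificate S` with sectors at least `[a₀_k, b₀_k]` exists; (ii) an
`LPSlabDualWitness S a₀ b₀` exists.
[cite: BoydVandenberghe2004, §5.9.4 (5.99)–(5.100), §5.8.2 p. 260, Example 5.14] -/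
theorem lpSlabCertificate_wider_xor_lpDualWitness (hlt : ∀ k, a₀ k < b₀ k) :
    Xor (Nonempty {Λ : LPSlabCertificate S // (∀ k, Λ.a k ≤ a₀ k) ∧ ∀ k, b₀ k ≤ Λ.b k})
      (Nonempty (LPSlabDualWitness S a₀ b₀)) := by
  rcases isEmpty_or_nonempty
      {Λ : LPSlabCertificate S // (∀ k, Λ.a k ≤ a₀ k) ∧ ∀ k, b₀ k ≤ Λ.b k} with h | h
  · exact Or.inr ⟨(lp_isEmpty_wider_iff_nonempty_lpDualWitness S hlt).mp h, not_nonempty_iff.mpr h⟩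
  · exact Or.inl ⟨h, fun ⟨D⟩ => (LPSlabCertificate.isEmpty_of_lpDualWitness D).false h.some⟩

/-- Restriction to the slopes for the positivity class (existence, by duality).
[cite: BoydVandenberghe2004, §5.9.4 (5.99)–(5.100) and Example 5.14] -/
theorem lp_exists_at_slopes_of_exists_wider (hlt : ∀ k, a₀ k < b₀ k) (Λ : LPSlabCertificate S)
    (ha : ∀ k, Λ.a k ≤ a₀ k) (hb : ∀ k, b₀ k ≤ Λ.b k) :
    ∃ Λ' : LPSlabCertificate S, Λ'.a = a₀ ∧ Λ'.b = b₀ := by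
  by_contra hne
  have hempty : IsEmpty {Λ : LPSlabCertificate S // Λ.a = a₀ ∧ Λ.b = b₀} :=
    ⟨fun ⟨Λ', h'⟩ => hne ⟨Λ', h'⟩⟩
  have hw := (lp_isEmpty_wider_iff_isEmpty S hlt).mpr hempty
  exact hw.false ⟨Λ, ha, hb⟩

end Exactness

end Literature.MathematicalPhysics.PowerSystems.LyapunovFunctionFamily
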